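import Mathlib
import Summits.KontsevichZagierPeriods.KontsevichZagierPeriods.Theses.InverseLandau
import Literature.NumberTheory.Transcendental.KZLogCalculusProofs

/-!
# `TateLifting`, line `Sketch`, stub `stub_logSectorAssembly` — the weight-one sector, assembled

Crux stmt-KontsevichZagierPeriods-9129 (`Summit.KontsevichZagierPeriods.KontsevichZagierPeriods.Theses.InverseLandau.TateLifting`).
From the four other weight-one stubs, taken as hypotheses verbatim — Baker decomposition, the log
unfolding `∫_{(0,1)} (x−1)/(1+(x−1)z₀) = log x`, the torus fibre (a multiplicative relation,
unfolded, is a generic fibre), integer multiples — the GENERATION statement of the line holds on the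
subgroup generated by the honest log representations `rᵢ = [(0,1), βᵢ (αᵢ−1)/(1+(αᵢ−1)z₀)]`
(`αᵢ > 0`, `αᵢ, βᵢ` real algebraic; value `βᵢ log αᵢ`): every `Σ mᵢ [rᵢ]` with vanishing evaluation
lies in `KZ.relations ⊔ closure 𝒢`.

Bookkeeping: `eval [rᵢ] = βᵢ log αᵢ` (log unfolding + `MeasureTheory.setIntegral_congr_fun`), so
`Σ (mᵢβᵢ) log αᵢ = 0`; Baker decomposition writes `mᵢβᵢ = Σ_q c_q M_q i` with `Π αᵢ^{M_q i} = 1`;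
the honest representations `ρ_q := [(0,1), c_q Σᵢ M_q i (αᵢ−1)/(1+(αᵢ−1)z₀)]` (semialgebraic:
`isSemialgebraicFunOn_const_of_isAlgebraic`, `isSemialgebraicFunOn_apply`, `.add_holds/.mul_holds/
.div_holds`; integrable: continuous on the compact closure, denominators `≥ min(1, αᵢ) > 0`) lie in
`𝒢` (torus fibre); and `Σ mᵢ [rᵢ] − Σ_q [ρ_q] ∈ KZ.relations` because the integrands agree pointwise
(`KZ.of_sub_of_sub_sum_mem_relations` through one total representation, integer multiples by the
`zsmul` stub).
-/

noncomputable section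

namespace Summit.KontsevichZagierPeriods.InverseLandau

open Literature.NumberTheory.Transcendental
open Literature.ModelTheory.ExponentialFields (IsSemialgebraic)
open MeasureTheory

/-! ### Helpers: the open unit cube of `ℝ¹` and the log kernel `(a − 1)/(1 + (a − 1) z₀)` -/

namespace LogSectorAssembly

/-- The open unit cube `(0,1)¹ ⊆ ℝ¹` is `ℚ`-semialgebraic. [folklore] -/
theorem isSemialgebraic_cube :
    IsSemialgebraic ℚ (Set.pi Set.univ (fun _ : Fin 1 => Set.Ioo (0 : ℝ) 1)) := by
  convert isSemialgebraic_unitInterval_fin_one using 1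
  ext z
  simp [Fin.forall_fin_one]

/-- The open unit cube `(0,1)¹ ⊆ ℝ¹` is Lebesgue measurable. [folklore] -/
theorem measurableSet_cube :
    MeasurableSet (Set.pi Set.univ (fun _ : Fin 1 => Set.Ioo (0 : ℝ) 1)) :=
  MeasurableSet.univ_pi fun _ => measurableSet_Ioo

/-- For `a > 0` and `t ∈ [0,1]` the log-kernel denominator `1 + (a − 1) t = (1 − t) + a t` is
positive. [folklore] -/
theorem denom_pos {a t : ℝ} (ha : 0 < a) (ht : t ∈ Set.Icc (0 : ℝ) 1) :
    0 < 1 + (a - 1) * t := by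
  rcases ht.2.lt_or_eq with h | h
  · nlinarith [mul_nonneg ha.le ht.1]
  · subst h; linarith

/-- The log kernel `z ↦ (a − 1)/(1 + (a − 1) z₀)` (`a > 0` real algebraic) is a `ℚ`-semialgebraic
function on the open unit cube (algebraic constants, a coordinate, `+`, `·`, `/`).
[cite: KontsevichZagier2001, §1.1] -/
theorem isSemialgebraicFunOn_kernel {a : ℝ} (ha : 0 < a) (haa : IsAlgebraic ℚ a) :
    IsSemialgebraicFunOn ℚ (Set.pi Set.univ (fun _ : Fin 1 => Set.Ioo (0 : ℝ) 1))
      (fun z => (a - 1) / (1 + (a - 1) * z 0)) := by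
  have hc : IsSemialgebraicFunOn ℚ (Set.pi Set.univ (fun _ : Fin 1 => Set.Ioo (0 : ℝ) 1))
      (fun _ => a - 1) :=
    isSemialgebraicFunOn_const_of_isAlgebraic isSemialgebraic_cube (haa.sub isAlgebraic_one)
  have hden : IsSemialgebraicFunOn ℚ (Set.pi Set.univ (fun _ : Fin 1 => Set.Ioo (0 : ℝ) 1))
      (fun z => 1 + (a - 1) * z 0) :=
    IsSemialgebraicFunOn.add_holds
      (isSemialgebraicFunOn_const_of_isAlgebraic isSemialgebraic_cube isAlgebraic_one)
      (IsSemialgebraicFunOn.mul_holds hc (isSemialgebraicFunOn_apply isSemialgebraic_cube 0))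
  exact hc.div hden fun z hz =>
    (denom_pos ha (Set.Ioo_subset_Icc_self ((Set.mem_univ_pi.1 hz) 0))).ne'

/-- Algebraic combinations `κ Σᵢ μᵢ (αᵢ − 1)/(1 + (αᵢ − 1) z₀)` of log kernels are
`ℚ`-semialgebraic on the open unit cube. [cite: KontsevichZagier2001, §1.1] -/
theorem isSemialgebraicFunOn_comb {s : ℕ} {α μ : Fin s → ℝ} {κ : ℝ} (hα : ∀ i, 0 < α i)
    (hαa : ∀ i, IsAlgebraic ℚ (α i)) (hμ : ∀ i, IsAlgebraic ℚ (μ i)) (hκ : IsAlgebraic ℚ κ) :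
    IsSemialgebraicFunOn ℚ (Set.pi Set.univ (fun _ : Fin 1 => Set.Ioo (0 : ℝ) 1))
      (fun z => κ * ∑ i, μ i * ((α i - 1) / (1 + (α i - 1) * z 0))) :=
  IsSemialgebraicFunOn.mul_holds (isSemialgebraicFunOn_const_of_isAlgebraic isSemialgebraic_cube hκ)
    (KZ.isSemialgebraicFunOn_finset_sum Finset.univ isSemialgebraic_cube fun i _ =>
      IsSemialgebraicFunOn.mul_holds
        (isSemialgebraicFunOn_const_of_isAlgebraic isSemialgebraic_cube (hμ i))
        (isSemialgebraicFunOn_kernel (hα i) (hαa i)))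

/-- Combinations of log kernels are continuous on the CLOSED unit cube `[0,1]¹` (denominators
`≥ min (1, αᵢ) > 0`). [folklore] -/
theorem continuousOn_comb {s : ℕ} {α : Fin s → ℝ} (μ : Fin s → ℝ) (κ : ℝ) (hα : ∀ i, 0 < α i) :
    ContinuousOn (fun z : Fin 1 → ℝ => κ * ∑ i, μ i * ((α i - 1) / (1 + (α i - 1) * z 0)))
      (Set.pi Set.univ (fun _ : Fin 1 => Set.Icc (0 : ℝ) 1)) := by
  refine continuousOn_const.mul (continuousOn_finsetSum _ fun i _ => continuousOn_const.mul ?_)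
  exact continuousOn_const.div (by fun_prop) fun z hz =>
    (denom_pos (hα i) ((Set.mem_univ_pi.1 hz) 0)).ne'

/-- Combinations of log kernels are integrable on the open unit cube (continuous on its compact
closure). [folklore] -/
theorem integrableOn_comb {s : ℕ} {α : Fin s → ℝ} (μ : Fin s → ℝ) (κ : ℝ) (hα : ∀ i, 0 < α i) :
    IntegrableOn (fun z : Fin 1 → ℝ => κ * ∑ i, μ i * ((α i - 1) / (1 + (α i - 1) * z 0)))
      (Set.pi Set.univ (fun _ : Fin 1 => Set.Ioo (0 : ℝ) 1)) :=
  ((continuousOn_comb μ κ hα).integrableOn_compact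
    (isCompact_univ_pi fun _ => isCompact_Icc)).mono_set
      (Set.pi_mono fun _ _ => Set.Ioo_subset_Icc_self)

/-- The honest representation `[(0,1)¹, κ Σᵢ μᵢ (αᵢ − 1)/(1 + (αᵢ − 1) z₀)]` exists
(`αᵢ > 0`; `αᵢ, μᵢ, κ` real algebraic). [cite: KontsevichZagier2001, §1.1] -/
theorem exists_combRep {s : ℕ} {α μ : Fin s → ℝ} {κ : ℝ} (hα : ∀ i, 0 < α i)
    (hαa : ∀ i, IsAlgebraic ℚ (α i)) (hμ : ∀ i, IsAlgebraic ℚ (μ i)) (hκ : IsAlgebraic ℚ κ) :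
    ∃ ρ : KZ.IntegralRep 1, ρ.domain = Set.pi Set.univ (fun _ : Fin 1 => Set.Ioo (0 : ℝ) 1) ∧
      ρ.integrand = fun z => κ * ∑ i, μ i * ((α i - 1) / (1 + (α i - 1) * z 0)) :=
  ⟨⟨_, _, isSemialgebraic_cube, isSemialgebraicFunOn_comb hα hαa hμ hκ, integrableOn_comb μ κ hα⟩,
    rfl, rfl⟩

/-- Integer multiples of a representation: `[σ, m · f]` exists for every `[σ, f]` and `m ∈ ℤ`.
[cite: KontsevichZagier2001, §1.2] -/
theorem exists_zsmulRep {n : ℕ} (m : ℤ) (r : KZ.IntegralRep n) :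
    ∃ R : KZ.IntegralRep n, R.domain = r.domain ∧ R.integrand = fun z => (m : ℝ) * r.integrand z :=
  ⟨⟨r.domain, fun z => (m : ℝ) * r.integrand z, r.isSemialgebraic_domain,
    IsSemialgebraicFunOn.mul_holds
      (isSemialgebraicFunOn_const_of_isAlgebraic r.isSemialgebraic_domain (isAlgebraic_int m))
      r.isSemialgebraicFunOn_integrand,
    r.integrableOn.const_mul _⟩, rfl, rfl⟩

end LogSectorAssembly

open LogSectorAssembly in

/-- **Weight-one sector of the generation statement** (stub `stub_logSectorAssembly` of line
`Sketch` for crux `TateLifting`), from its four ingredients taken as hypotheses.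
[cite: KontsevichZagier2001, §1.2] -/
theorem tateLifting_logSectorAssembly :
    -- Baker decomposition
    (∀ (s : ℕ) (α w : Fin s → ℝ), (∀ i, 0 < α i) → (∀ i, IsAlgebraic ℚ (α i)) →
      (∀ i, IsAlgebraic ℚ (w i)) → ∑ i, w i * Real.log (α i) = 0 →
      ∃ (t : ℕ) (M : Fin t → Fin s → ℤ) (c : Fin t → ℝ), (∀ q, IsAlgebraic ℚ (c q)) ∧
        (∀ q, ∏ i, α i ^ (M q i) = 1) ∧ ∀ i, w i = ∑ q, c q * (M q i : ℝ)) →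
    -- log unfolding
    (∀ x : ℝ, 0 < x →
      ∫ z in Set.pi Set.univ (fun _ : Fin 1 => Set.Ioo (0 : ℝ) 1),
        (x - 1) / (1 + (x - 1) * z 0) = Real.log x) →
    -- torus fibre
    (∀ (s : ℕ) (α : Fin s → ℝ) (v : Fin s → ℤ) (lam : ℝ) (ρ : KZ.IntegralRep 1),
      (∀ i, 0 < α i) → (∀ i, IsAlgebraic ℚ (α i)) → IsAlgebraic ℚ lam →
      ∏ i, α i ^ (v i) = 1 →
      ρ.domain = Set.pi Set.univ (fun _ : Fin 1 => Set.Ioo (0 : ℝ) 1) →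
      Set.EqOn ρ.integrand
        (fun z => lam * ∑ i, (v i : ℝ) * ((α i - 1) / (1 + (α i - 1) * z 0))) ρ.domain →
      KZ.of ρ ∈
        {d : KZ.FormalRep | ∃ (n k : ℕ) (P Q : MvPolynomial (Fin (n + k)) ℚ) (U : Set (Fin k → ℝ))
            (γ : ℝ → (Fin k → ℝ)) (a : Fin k → ℝ) (r : KZ.IntegralRep n),
          IsOpen U ∧ ContinuousOn γ (Set.Icc 0 1) ∧ γ 0 = 0 ∧ γ 1 = a ∧
          (∀ t ∈ Set.Icc (0 : ℝ) 1, γ t ∈ U) ∧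
          (∃ c₀ : ℚ, c₀ ≠ 0 ∧ ∀ z : Fin n → ℝ,
            MvPolynomial.aeval (Fin.append z (0 : Fin k → ℝ)) Q = (c₀ : ℝ)) ∧
          (∀ (z : Fin n → ℝ) (u : Fin k → ℝ), (∀ i, z i ∈ Set.Icc (0 : ℝ) 1) → u ∈ U →
            MvPolynomial.aeval (Fin.append z u) Q ≠ 0) ∧
          (∀ u ∈ U, ∫ z in Set.pi Set.univ (fun _ : Fin n => Set.Ioo (0 : ℝ) 1),
            MvPolynomial.aeval (Fin.append z u) P / MvPolynomial.aeval (Fin.append z u) Q = 0) ∧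
          (∀ j, IsAlgebraic ℚ (a j)) ∧
          r.domain = Set.pi Set.univ (fun _ : Fin n => Set.Ioo (0 : ℝ) 1) ∧
          Set.EqOn r.integrand (fun z => MvPolynomial.aeval (Fin.append z a) P /
            MvPolynomial.aeval (Fin.append z a) Q) r.domain ∧
          d = KZ.of r}) →
    -- integer multiples
    (∀ (n : ℕ) (m : ℤ) (r r' : KZ.IntegralRep n), r'.domain = r.domain →
      Set.EqOn r'.integrand (fun x => (m : ℝ) * r.integrand x) r.domain →
      KZ.of r' - m • KZ.of r ∈ KZ.relations) →
    -- the weight-one sector of `GenLifting`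
    ∀ (s : ℕ) (α β : Fin s → ℝ) (m : Fin s → ℤ) (r : Fin s → KZ.IntegralRep 1),
      (∀ i, 0 < α i) → (∀ i, IsAlgebraic ℚ (α i)) → (∀ i, IsAlgebraic ℚ (β i)) →
      (∀ i, (r i).domain = Set.pi Set.univ (fun _ : Fin 1 => Set.Ioo (0 : ℝ) 1)) →
      (∀ i, Set.EqOn (r i).integrand
        (fun z => β i * ((α i - 1) / (1 + (α i - 1) * z 0))) (r i).domain) →
      KZ.eval (∑ i, m i • KZ.of (r i)) = 0 →
      ∑ i, m i • KZ.of (r i) ∈ KZ.relations ⊔ AddSubgroup.closure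
        {d : KZ.FormalRep | ∃ (n k : ℕ) (P Q : MvPolynomial (Fin (n + k)) ℚ) (U : Set (Fin k → ℝ))
            (γ : ℝ → (Fin k → ℝ)) (a : Fin k → ℝ) (r : KZ.IntegralRep n),
          IsOpen U ∧ ContinuousOn γ (Set.Icc 0 1) ∧ γ 0 = 0 ∧ γ 1 = a ∧
          (∀ t ∈ Set.Icc (0 : ℝ) 1, γ t ∈ U) ∧
          (∃ c₀ : ℚ, c₀ ≠ 0 ∧ ∀ z : Fin n → ℝ,
            MvPolynomial.aeval (Fin.append z (0 : Fin k → ℝ)) Q = (c₀ : ℝ)) ∧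
          (∀ (z : Fin n → ℝ) (u : Fin k → ℝ), (∀ i, z i ∈ Set.Icc (0 : ℝ) 1) → u ∈ U →
            MvPolynomial.aeval (Fin.append z u) Q ≠ 0) ∧
          (∀ u ∈ U, ∫ z in Set.pi Set.univ (fun _ : Fin n => Set.Ioo (0 : ℝ) 1),
            MvPolynomial.aeval (Fin.append z u) P / MvPolynomial.aeval (Fin.append z u) Q = 0) ∧
          (∀ j, IsAlgebraic ℚ (a j)) ∧
          r.domain = Set.pi Set.univ (fun _ : Fin n => Set.Ioo (0 : ℝ) 1) ∧
          Set.EqOn r.integrand (fun z => MvPolynomial.aeval (Fin.append z a) P /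
            MvPolynomial.aeval (Fin.append z a) Q) r.domain ∧
          d = KZ.of r} := by
  intro hB hL hT hZ s α β m r hα hαa hβa hdom hint hev
  -- (1) values: `eval [rᵢ] = βᵢ log αᵢ`, so `Σ (mᵢ βᵢ) log αᵢ = 0`
  have hval : ∀ i, KZ.eval (KZ.of (r i)) = β i * Real.log (α i) := by
    intro i
    rw [KZ.eval_of, KZ.IntegralRep.value, hdom i,
      setIntegral_congr_fun measurableSet_cube (fun z hz => hint i (by rw [hdom i]; exact hz)),
      integral_const_mul, hL (α i) (hα i)]
  have h1 : ∑ i, ((m i : ℝ) * β i) * Real.log (α i) = 0 := by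
    simpa only [map_sum, map_zsmul, hval, zsmul_eq_mul, mul_assoc] using hev
  -- (2) Baker decomposition of the coefficient vector `mᵢ βᵢ`
  obtain ⟨t, M, c, hc, hM, hw⟩ := hB s α (fun i => (m i : ℝ) * β i) hα hαa
    (fun i => (isAlgebraic_int (m i)).mul (hβa i)) h1
  have hw' : ∀ i, (m i : ℝ) * β i = ∑ q, c q * (M q i : ℝ) := hw
  -- (3) the honest representations `ρ_q` of `c_q Σᵢ M_q i (αᵢ − 1)/(1 + (αᵢ − 1) z₀)`
  choose ρ hρd hρi using fun q : Fin t =>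
    exists_combRep (μ := fun i => (M q i : ℝ)) hα hαa (fun i => isAlgebraic_int (M q i)) (hc q)
  -- (4) relations: integer multiples `R' i = [(0,1), mᵢ · (r i).integrand]`, the total
  -- representation `Rtot = [(0,1), Σᵢ mᵢ βᵢ (αᵢ − 1)/(1 + (αᵢ − 1) z₀)]` and a zero representation
  choose R' hR'd hR'i using fun i => exists_zsmulRep (m i) (r i)
  have hR' : ∀ i, KZ.of (R' i) - m i • KZ.of (r i) ∈ KZ.relations := fun i =>
    hZ 1 (m i) (r i) (R' i) (hR'd i) fun z _ => by rw [hR'i i]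
  obtain ⟨Rtot, hRtd, hRti⟩ := exists_combRep (μ := fun i => (m i : ℝ) * β i) (κ := 1) hα hαa
    (fun i => (isAlgebraic_int (m i)).mul (hβa i)) isAlgebraic_one
  obtain ⟨R0, hR0d, hR0i⟩ := KZ.exists_zeroRep (n := 1) isSemialgebraic_cube
  have hsum1 : KZ.of Rtot - KZ.of R0 - ∑ i, KZ.of (R' i) ∈ KZ.relations := by
    refine KZ.of_sub_of_sub_sum_mem_relations s Rtot R0 R' (hR0d.trans hRtd.symm)
      (fun i => (hR'd i).trans ((hdom i).trans hRtd.symm)) fun z hz => ?_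
    rw [hRtd] at hz
    simp only [hRti, hR0i, hR'i, Pi.zero_apply, zero_add, one_mul]
    refine Finset.sum_congr rfl fun i _ => ?_
    rw [hint i (by rw [hdom i]; exact hz)]
    simp only [mul_assoc]
  have hsum2 : KZ.of Rtot - KZ.of R0 - ∑ q, KZ.of (ρ q) ∈ KZ.relations := by
    refine KZ.of_sub_of_sub_sum_mem_relations t Rtot R0 ρ (hR0d.trans hRtd.symm)
      (fun q => (hρd q).trans hRtd.symm) fun z _ => ?_
    simp only [hRti, hR0i, hρi, Pi.zero_apply, zero_add, one_mul]
    calc ∑ i, (m i : ℝ) * β i * ((α i - 1) / (1 + (α i - 1) * z 0))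
        = ∑ i, ∑ q, c q * ((M q i : ℝ) * ((α i - 1) / (1 + (α i - 1) * z 0))) := by
          refine Finset.sum_congr rfl fun i _ => ?_
          rw [hw' i, Finset.sum_mul]
          simp only [mul_assoc]
      _ = ∑ q, ∑ i, c q * ((M q i : ℝ) * ((α i - 1) / (1 + (α i - 1) * z 0))) := Finset.sum_comm
      _ = ∑ q, c q * ∑ i, (M q i : ℝ) * ((α i - 1) / (1 + (α i - 1) * z 0)) := by
          simp only [Finset.mul_sum]
  have h3 : ∑ i, KZ.of (R' i) - ∑ q, KZ.of (ρ q) ∈ KZ.relations := by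
    have h := KZ.relations.sub_mem hsum2 hsum1
    rwa [show KZ.of Rtot - KZ.of R0 - ∑ q, KZ.of (ρ q) -
        (KZ.of Rtot - KZ.of R0 - ∑ i, KZ.of (R' i)) =
      ∑ i, KZ.of (R' i) - ∑ q, KZ.of (ρ q) by abel] at h
  -- (5) bookkeeping in the free abelian group
  have key : ∑ i, m i • KZ.of (r i) = ∑ q, KZ.of (ρ q) +
      ((∑ i, KZ.of (R' i) - ∑ q, KZ.of (ρ q)) - ∑ i, (KZ.of (R' i) - m i • KZ.of (r i))) := by
    rw [Finset.sum_sub_distrib]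
    abel
  rw [key]
  refine add_mem (AddSubgroup.mem_sup_right ?_) (AddSubgroup.mem_sup_left ?_)
  · exact AddSubgroup.sum_mem _ fun q _ => AddSubgroup.subset_closure
      (hT s α (M q) (c q) (ρ q) hα hαa (hc q) (hM q) (hρd q) fun z _ => by rw [hρi q])
  · exact KZ.relations.sub_mem h3 (KZ.relations.sum_mem fun i _ => hR' i)

end Summit.KontsevichZagierPeriods.InverseLandau

end
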